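import Summits.QuantumFields.YangMills.Theorems.UV3PinnedStepV3FaceOfPackage
import Summits.QuantumFields.YangMills.Theorems.UV3PinnedStepKnitOfPackage
import Summits.QuantumFields.YangMills.Theorems.UV3UnitDensityUpperOfPackage
import Literature.MathematicalPhysics.QuantumFieldTheory.Balaban1983to89.T3CruxEstimates
import HarnessLib

/-!
# THE PINNED-STABILITY LINE'S CRUX FACE (v1 socket, ONE currency) — `UnitScaleTilt.HistoryTailL` FROM THE T3 (α) SOCKET `∀ L, AlphaInputsT3AC L`, THE POLYMER FIELDS,
# THE EX-LANE MAIN-TERM ROW, AND THE TWO LARGE-FIELD ORGAN ROWS READ `dV`-A.E.: `hSii` (PINNED resummation, restricted history sum) and `hlf` (UN-PINNED, the leaf B25 at `k = K`)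

Cell `ym3-torus` (YM ladder rung R3 = continuum `SU(2)` Yang–Mills on the three-torus — a RUNG, NOT d = 4, NOT infinite volume, NOT a mass gap, NOT Clay).
Twin-width seat `ym-ust-19936-w8` (gen 11); `--supports stmt-QuantumFields-19936 --as helper`, count-neutral, definition-free, default heartbeats.
Crux `UnitScaleTilt.HistoryTailL` (stmt-QuantumFields-19936), skeleton of record `Cruxes/HistoryTailL/Lines/pinned_stability.lean` v3 (de3325bf, ideator `ym-r3-idea-2` g17; R-a′ letters).
★★OWNER WORDS 57∕58: display letter = the final organ rows, one currency; `ym-ust-19936-w6` g7 LOCATE-S-ORGAN: both organ rows reduce further to ONE row hJ (the top-level a.e. MASS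
ENVELOPE of the K-fold transported history masses of `blockAvg ℰp`) by typable bookkeeping (its FILES 1–3) — the hJ-lettered twin of §2 is appended when those land.
**A CONDITIONAL THEOREM WITH DISPLAYED ORGAN ROWS.  IT DOES NOT PROVE `HistoryTailL`.**

THE CHAIN, ALL BY NAME (v1 socket `AlphaInputsT3AC.Of`, datum `dataT3`, package record `PkgAt`):
* S: `stub_pinnedStep` (v3 text) ⟸ ✓`UV3PinnedStepV3FaceOfPackage.stub_pinnedStepV3_of_package_of_purePinTop_of_main (hpkg)(π)(hMain)(hPinA)` (this seat) and `hPinA` ⟸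
  ✓∕⧗`UV3PinnedStepKnitOfPackage.hPinA_of_pinnedLF (π)(hSii)` (`ym3-torus-px8` g11: BRICKS A∕B2a∕B2b∕C — the pinned Thm-2 induction above the pin from the `RunAlphaAC` rows — plus
  (46) ✓`AlphaInputsT3ACPint` and the remainder size);
* U: `stub_unitEnvelope` ⟸ ✓`UV3UnitDensityUpperOfPackage.stub_unitEnvelope_of_package_of_lf_ae_of_main (π)(hpkg)(hlf)(hMain)` (this seat; (41)′, (46), `Rm`, `LFShape`, the (47)-half
  ✓`UV3UnitPartitionLowerOfPackage` + ✓`AlphaInputsT3ACPint`);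
* door: §1 `pinnedHeightTail_of'` — the registered skeleton's rate-blind §2 (S-step → S-low → `hP′`), re-typed here (Cruxes modules are not importable into Theorems);
* socket (downstream, one `exact`): the LEAD's K-19′ ✓`UnitScaleTiltHistoryTailOfPinnedHeightTailFreeRate.historyTailL_of_pinnedHeightTail_freeRate (hP′)`.
§2 ★★★ `pinnedHeightTail_of_package_of_pinnedLF_of_lf_ae_of_main (hpkg) (π) (hMain) (hSii) (hlf) : ⟨hP′, the K-19′ socket's hypothesis verbatim⟩` — the crux BY NAME is then the
one-line composition with the socket, filed separately as `UnitScaleTiltHistoryTailOfPackagePinnedLfCrux` (so that this file does not wait on the socket's olean).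

THE ROWS DISPLAYED.  `hpkg : ∀ L, AlphaInputsT3AC L` — the UV3 node's (α) input package at the T³ objects (hypothesis schema; closed modulo its Tier A–E inputs).  `π` — polymer fields (data).
`hMain` — the trivial-history main term bounded on the unit-lattice window ([Balaban1985Variational] Thm 1 (8): the EX lane's membership row).  `hSii` — per `(L, 𝔠)`, depth `m`, a threshold,
and per family∕coupling: `Σ_{r ∈ H(K,j,a)} m_K(r,W)·e^{−mainT_K(r,W)+Zterm_K(r)} ≤ e^{CZ}·β_{K−j}^A·e^{−c·p_𝔠(g_{K−j})²}` for `dV_K`-a.e. `W` (the PINNED large-field resummation (67)–(71) +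
[9] §3.C over the pinned-or-collar histories `H(K,j,a)`; `ym3-torus-px8` g11's letter, RULING №32 a.e. form).  `hlf` — per `(F, 𝔠, h, γ)`: `LF_K(W)[−mainT + Zterm] ≤ e^{CZ}` for `dV_K`-a.e. `W`,
every `K` (the UN-PINNED resummation = the END theorem's leaf B25 at `k = K`).  Both organ rows are instances of ONE resummation and both reduce to hJ (w6 g7 §3).

HONEST SCOPE.  A face: conclusion = the crux BY NAME, hypotheses = five named rows; it closes nothing — `hSii`∕`hlf` ARE Bałaban's large-field control for the `blockAvg ℰp` tower,
`hpkg` is the (α) package, `hMain` the EX lane.  Nothing of `stub_pinnedStep`, `stub_unitEnvelope`, `hP′`, `HistoryTailL` (19936) or the rung is proved here.  Sorry-free, axioms standard.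

References: T. Bałaban, *Ultraviolet stability of three-dimensional lattice pure gauge field theories*, Commun. Math. Phys. **102** (1985) 255–275
[Balaban1985UV3] ((2) p.256, (5)–(7) pp.256–257, (41) p.266, (46)–(47) p.267, (64) p.273, (67), (70)–(71) p.273, pp.273–274); T. Bałaban, Commun. Math. Phys. **102** (1985)
277–309 [Balaban1985Variational] (Thm 1 (8) p.279).
-/

set_option autoImplicit false

noncomputable section

namespace Summit.QuantumFields.YangMills.Theorems.UnitScaleTiltHistoryTailOfPackagePinnedLf

open scoped BigOperators
open MeasureTheory
open Literature.MathematicalPhysics.QuantumFieldTheory.Balaban1983to89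
open Literature.MathematicalPhysics.QuantumFieldTheory.Balaban1983to89.T3ContinuumYM3Torus
open Literature.MathematicalPhysics.QuantumFieldTheory.Balaban1983to89.T3UnitScaleTilt
open Literature.MathematicalPhysics.QuantumFieldTheory.Balaban1983to89.T3UnitLawDensityEML
open Literature.MathematicalPhysics.QuantumFieldTheory.Balaban1983to89.T3RestrictedUnitDensity
open Literature.MathematicalPhysics.QuantumFieldTheory.Balaban1983to89.T3CruxEstimates
open Literature.MathematicalPhysics.QuantumFieldTheory.Balaban1983to89.T3AlphaInputsAC
open Literature.MathematicalPhysics.QuantumFieldTheory.Balaban1983to89.Missing (partitionFn partitionFn_pos' isProbabilityMeasure_fieldMeasure)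
open Literature.MathematicalPhysics.QuantumFieldTheory.Balaban1985CMP102
open Literature.MathematicalPhysics.QuantumFieldTheory.Balaban1985CMP102.Setting
open Summit.QuantumFields.Balaban3D.Carriers
open Summit.QuantumFields.Balaban3D.Proofs.Primitives
open Summit.QuantumFields.Balaban3D.Proofs.StandardAC
open Summit.QuantumFields.Balaban3D.Proofs.InputsAC
open Summit.QuantumFields.YangMills.Theorems.UV3PinnedStepProfileReduction (measurableSet_pinEvent)
open Summit.QuantumFields.YangMills.Theorems.UV3PinnedStepV3FaceOfPackage (stub_pinnedStepV3_of_package_of_purePinTop_of_main)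
open Summit.QuantumFields.YangMills.Theorems.UV3PinnedStepKnitOfPackage (hPinA_of_pinnedLF)
open Summit.QuantumFields.YangMills.Theorems.UV3UnitDensityUpperOfPackage (stub_unitEnvelope_of_package_of_lf_ae_of_main)

/-! ## §1 The rate-blind door (the registered skeleton's §2, re-typed): S-step (v3) → S-low → `hP′` -/

/-- **THE PINNED HEIGHT TAIL `hP′` (the K-19′ socket's hypothesis, verbatim) FROM THE TWO Z-LEVEL STUB STATEMENTS (v3 letters)** — the registered skeleton's sorry-free §2 door
`PinnedStability.pinnedHeightTail_of`, re-typed here because Cruxes modules are not importable into Theorems.  Per `(K, j, a)`: `Gibbs_K(E) = (∫ ρ^E_K dV_K) ∕ Z_K`, numerator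
`≤ (e^{Cl}·Z_K)·e^{Cu}·w` (S-step at the envelope `M := e^{Cl}·Z_K` supplied by S-low, `integral_mono_ae`), so `Gibbs_K(E) ≤ e^{Cu+Cl}·w`; `C := e^{Cu+Cl}`, `γ₁ := min`, rate profile
`(b, p)` passed through. [cite: Balaban1985UV3, (2) p.256, (6)-(7) p.257] -/
theorem pinnedHeightTail_of'
    (hStep : ∀ (L : ℕ), ∃ (b₁' p₁' : ℝ), ∀ (b₀ p₀ : ℝ), b₁' ≤ b₀ → p₁' ≤ p₀ → 0 < b₀ → 2 < p₀ → ∀ (m : ℕ), 0 < m →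
      ∃ γ₁ : ℝ, 0 < γ₁ ∧ γ₁ ≤ 1 ∧ ∀ (F : T3Family) (γ : ℝ), F.L = L → 0 < γ → γ ≤ γ₁ →
        ∃ (b p Cu c : ℝ) (A : ℕ), 0 < b ∧ 1 ≤ p ∧ 0 < c ∧
          ∀ (K j : ℕ), 1 ≤ j → j + 2 ≤ K → j + (K - 1) / m ≤ K → ∀ (a : Plaq (F.P K) j) (M : ℝ),
          (∀ᵐ V ∂(fieldMeasure (F.P K) K (Matrix.specialUnitaryGroup (Fin 2) ℂ)), emlDensity F γ K K V ≤ M) →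
          ∀ᵐ V ∂(fieldMeasure (F.P K) K (Matrix.specialUnitaryGroup (Fin 2) ℂ)),
            resDensity F γ K
              ({U : GaugeField (F.P K) 0 (Matrix.specialUnitaryGroup (Fin 2) ℂ) |
                  θBal F.L γ b₀ p₀ (K - j) ≤ GaugeGroup.dist1 (GaugeField.plaqHol
                    (Averaging.iter (fun i' => BlockAveraging.blockAvg (P := F.P K) (j := i') ℰp) j U) a)} ∩
                {U : GaugeField (F.P K) 0 (Matrix.specialUnitaryGroup (Fin 2) ℂ) | ∀ i, i < j →
                  PlaqSmall (θBal F.L γ b₀ p₀ (K - i))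
                    (Averaging.iter (fun i' => BlockAveraging.blockAvg (P := F.P K) (j := i') ℰp) i U)})
              K V ≤
            M * Real.exp Cu *
              ((F.scheme ℰp γ).β (K - j) ^ A * Real.exp (-(c * B10.pFun b p (Real.sqrt (γ * ((F.L : ℝ)⁻¹) ^ (K - j))) ^ 2))))
    (hLow : ∀ (L : ℕ), ∃ γ₁ : ℝ, 0 < γ₁ ∧ ∀ (F : T3Family) (γ : ℝ), F.L = L → 0 < γ → γ ≤ γ₁ →
      ∃ Cl : ℝ, ∀ K : ℕ, ∀ᵐ V ∂(fieldMeasure (F.P K) K (Matrix.specialUnitaryGroup (Fin 2) ℂ)),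
        emlDensity F γ K K V ≤
          Real.exp Cl * partitionFn (G := Matrix.specialUnitaryGroup (Fin 2) ℂ) (F.P K) ((F.scheme ℰp γ).β K)) :
    ∀ (L : ℕ), ∃ (b₁' p₁' : ℝ), ∀ (b₀ p₀ : ℝ), b₁' ≤ b₀ → p₁' ≤ p₀ → 0 < b₀ → 2 < p₀ → ∀ (m : ℕ), 0 < m →
      ∃ γ₁ : ℝ, 0 < γ₁ ∧ γ₁ ≤ 1 ∧ ∀ (F : T3Family) (γ : ℝ), F.L = L → 0 < γ → γ ≤ γ₁ →
        ∃ (b p C c : ℝ) (A : ℕ), 0 < b ∧ 1 ≤ p ∧ 0 ≤ C ∧ 0 < c ∧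
          ∀ (K j : ℕ), 1 ≤ j → j + 2 ≤ K → j + (K - 1) / m ≤ K → ∀ a : Plaq (F.P K) j,
          (gibbsK F ℰp γ K).real
              ({U : GaugeField (F.P K) 0 (Matrix.specialUnitaryGroup (Fin 2) ℂ) |
                  θBal F.L γ b₀ p₀ (K - j) ≤ GaugeGroup.dist1 (GaugeField.plaqHol
                    (Averaging.iter (fun i' => BlockAveraging.blockAvg (P := F.P K) (j := i') ℰp) j U) a)} ∩
                {U : GaugeField (F.P K) 0 (Matrix.specialUnitaryGroup (Fin 2) ℂ) | ∀ i, i < j →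
                  PlaqSmall (θBal F.L γ b₀ p₀ (K - i))
                    (Averaging.iter (fun i' => BlockAveraging.blockAvg (P := F.P K) (j := i') ℰp) i U)}) ≤
            C * (F.scheme ℰp γ).β (K - j) ^ A *
              Real.exp (-(c * B10.pFun b p (Real.sqrt (γ * ((F.L : ℝ)⁻¹) ^ (K - j))) ^ 2)) := by
  intro L
  obtain ⟨b₁', p₁', HS⟩ := hStep L
  obtain ⟨γL, hγL, HL⟩ := hLow L
  refine ⟨b₁', p₁', fun b₀ p₀ hb hp hb₀ hp₀ m hm => ?_⟩
  obtain ⟨γ₁, hγ₁, hγ₁1, HF⟩ := HS b₀ p₀ hb hp hb₀ hp₀ m hm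
  refine ⟨min γ₁ γL, lt_min hγ₁ hγL, (min_le_left _ _).trans hγ₁1, fun F γ hFL hγ hγle => ?_⟩
  obtain ⟨b, p, Cu, c, A, hb0, hp1, hc, hstep⟩ := HF F γ hFL hγ (hγle.trans (min_le_left _ _))
  obtain ⟨Cl, hlow⟩ := HL F γ hFL hγ (hγle.trans (min_le_right _ _))
  refine ⟨b, p, Real.exp (Cu + Cl), c, A, hb0, hp1, (Real.exp_pos _).le, hc, fun K j hj1 hjK hjm a => ?_⟩
  -- names
  set E : Set (GaugeField (F.P K) 0 (Matrix.specialUnitaryGroup (Fin 2) ℂ)) :=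
    {U : GaugeField (F.P K) 0 (Matrix.specialUnitaryGroup (Fin 2) ℂ) |
        θBal F.L γ b₀ p₀ (K - j) ≤ GaugeGroup.dist1 (GaugeField.plaqHol
          (Averaging.iter (fun i' => BlockAveraging.blockAvg (P := F.P K) (j := i') ℰp) j U) a)} ∩
      {U : GaugeField (F.P K) 0 (Matrix.specialUnitaryGroup (Fin 2) ℂ) | ∀ i, i < j →
        PlaqSmall (θBal F.L γ b₀ p₀ (K - i))
          (Averaging.iter (fun i' => BlockAveraging.blockAvg (P := F.P K) (j := i') ℰp) i U)} with hEdef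
  set w : ℝ := (F.scheme ℰp γ).β (K - j) ^ A *
    Real.exp (-(c * B10.pFun b p (Real.sqrt (γ * ((F.L : ℝ)⁻¹) ^ (K - j))) ^ 2)) with hwdef
  set Z : ℝ := partitionFn (G := Matrix.specialUnitaryGroup (Fin 2) ℂ) (F.P K) ((F.scheme ℰp γ).β K) with hZdef
  have hγ0 : 0 ≤ γ := hγ.le
  have hw : 0 ≤ w := mul_nonneg (pow_nonneg (F.scheme_β_nonneg ℰp hγ0 (K - j)) A) (Real.exp_nonneg _)
  have hZ : 0 < Z := partitionFn_pos' _ (F.scheme_β_nonneg ℰp hγ0 K)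
  -- measurability of the event (✓`UV3PinnedStepProfileReduction.measurableSet_pinEvent`)
  have hE : MeasurableSet E := measurableSet_pinEvent F γ K b₀ p₀ (by omega) a
  -- (2)/(6): the Gibbs probability of `E` is the integral of the final restricted density over `Z_K`
  have hrepr : (gibbsK F ℰp γ K).real E =
      (∫ V, resDensity F γ K E K V ∂fieldMeasure (F.P K) K (Matrix.specialUnitaryGroup (Fin 2) ℂ)) / Z := by
    have e := real_gibbsK_iter_mem F hγ0 K 0 (Nat.zero_le _) hE
    have e' : (gibbsK F ℰp γ K).real E =
        (∫ V in E, emlDensity F γ K 0 V ∂fieldMeasure (F.P K) 0 (Matrix.specialUnitaryGroup (Fin 2) ℂ)) / Z := e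
    rw [e', ← integral_indicator hE]
    congr 1
    have h1 := integral_resDensity_mul F K hE hγ0 (k := K) (Nat.le_add_left K F.m) (fun _ => (1 : ℝ)) measurable_const
      ⟨1, fun _ => by simp⟩
    simp only [mul_one] at h1
    rw [h1]
    rfl
  -- a.e.: ρ^E_K ≤ (e^{Cl}·Z_K)·e^{Cu}·w — S-step fed with S-low's a.e. envelope `M := e^{Cl}·Z_K`
  have hae : ∀ᵐ V ∂(fieldMeasure (F.P K) K (Matrix.specialUnitaryGroup (Fin 2) ℂ)),
      resDensity F γ K E K V ≤ (Real.exp Cl * Z) * Real.exp Cu * w :=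
    hstep K j hj1 hjK hjm a (Real.exp Cl * Z) (hlow K)
  -- integrate over the last fibre (product Haar is a probability measure)
  haveI : IsProbabilityMeasure (fieldMeasure (F.P K) K (Matrix.specialUnitaryGroup (Fin 2) ℂ)) :=
    isProbabilityMeasure_fieldMeasure _ _
  have hnum : (∫ V, resDensity F γ K E K V ∂fieldMeasure (F.P K) K (Matrix.specialUnitaryGroup (Fin 2) ℂ)) ≤
      (Real.exp Cl * Z) * Real.exp Cu * w := by
    have hmono := integral_mono_ae (integrable_resDensity F K hE hγ0 (k := K) (Nat.le_add_left K F.m))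
      (integrable_const ((Real.exp Cl * Z) * Real.exp Cu * w)) hae
    simpa [integral_const, smul_eq_mul] using hmono
  -- assemble
  rw [hrepr, div_le_iff₀ hZ]
  calc (∫ V, resDensity F γ K E K V ∂fieldMeasure (F.P K) K (Matrix.specialUnitaryGroup (Fin 2) ℂ))
      ≤ (Real.exp Cl * Z) * Real.exp Cu * w := hnum
    _ = Real.exp (Cu + Cl) * ((F.scheme ℰp γ).β (K - j) ^ A *
          Real.exp (-(c * B10.pFun b p (Real.sqrt (γ * ((F.L : ℝ)⁻¹) ^ (K - j))) ^ 2))) * Z := by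
        rw [Real.exp_add, hwdef]; ring
    _ = Real.exp (Cu + Cl) * (F.scheme ℰp γ).β (K - j) ^ A *
          Real.exp (-(c * B10.pFun b p (Real.sqrt (γ * ((F.L : ℝ)⁻¹) ^ (K - j))) ^ 2)) * Z := by ring


/-! ## §2 The pinned height tail `hP′` (the LEAD's K-19′ socket hypothesis, verbatim) over the v1 socket from `hpkg`, `π`, `hMain`, `hSii`, `hlf` -/

open Classical in
/-- ★★★ **THE PINNED HEIGHT TAIL `hP′` (K-19′'s hypothesis, VERBATIM) FROM THE v1 (α) SOCKET, THE POLYMER FIELDS, THE MAIN-TERM ROW AND THE TWO LARGE-FIELD ORGAN ROWS READ A.E.** —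
`hSii` (the pinned restricted-sum resummation, `ym3-torus-px8` g11's (S-KNIT) letter) and `hlf` (the un-pinned top-level leaf, a.e.): S-face ∘ S-KNIT, U-face (a.e.), the door
`pinnedHeightTail_of'`.  The crux `HistoryTailL` is then ONE `exact` through the LEAD's K-19′ socket ✓`historyTailL_of_pinnedHeightTail_freeRate` (file
`UnitScaleTiltHistoryTailOfPackagePinnedLfCrux`).  CONDITIONAL; it proves nothing of the organs. [cite: Balaban1985UV3, Thm 1 (5) p.256, (41) p.266, (47) p.267, (67), (70)-(71) p.273, pp.273-274] -/
theorem pinnedHeightTail_of_package_of_pinnedLF_of_lf_ae_of_main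
    (hpkg : ∀ L : ℕ, AlphaInputsT3AC L)
    (π : ∀ F : T3Family, AlphaInputsT3AC.PolymerT3 F)
    (hMain : ∀ (F : T3Family) (𝔠 : AlphaConsts F.L (suGroupModel 2).N) (h : AlphaInputsT3AC.Of F 𝔠) (γ : ℝ) (hγ : 0 < γ)
      (hγ1 : γ ≤ (min 𝔠.gamma0 1) ^ 2), ∃ Cm : ℝ, ∀ (K : ℕ) (W : GaugeField (F.P K) K (Matrix.specialUnitaryGroup (Fin 2) ℂ)),
        PlaqSmall (θBal F.L γ 𝔠.b₀ 𝔠.p₀ 0) W →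
          (h.dataT3 γ hγ hγ1 (π F)).mainT K K ((h.dataT3 γ hγ hγ1 (π F)).triv K K) W ≤ Cm)
    (hSii : ∀ (L : ℕ) (𝔠 : AlphaConsts L (suGroupModel 2).N)
      (hOf : ∀ (F : T3Family) (hF : F.L = L), AlphaInputsT3AC.Of F (hF ▸ 𝔠)),
        ∀ (m : ℕ), 0 < m →
          ∃ γ₁ : ℝ, 0 < γ₁ ∧ ∀ (F : T3Family) (hF : F.L = L)
            (γ : ℝ) (hγ : 0 < γ) (hγ1' : γ ≤ (min (hF ▸ 𝔠).gamma0 1) ^ 2), γ ≤ γ₁ →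
            ∃ (CZ c : ℝ) (A : ℕ), 0 < c ∧
              ∀ (K j : ℕ) (hj1 : 1 ≤ j) (hjK : j + 2 ≤ K), j + (K - 1) / m ≤ K → ∀ (a : Plaq (F.P K) j),
                ∀ᵐ W ∂(fieldMeasure (F.P K) K (Matrix.specialUnitaryGroup (Fin 2) ℂ)),
                ∑ r ∈ Finset.univ.filter (fun r : Hist (F.P K) K =>
                    a ∈ r ⟨j, by omega⟩ ∨ ¬ plaqCover a ⊆ Omega (hF ▸ 𝔠).lane.carrier.M₁
                      (rcolOf (T3Scales F γ hγ (hγ1'.trans (sq_min_one_le _ (hF ▸ 𝔠).gamma0_pos)) K) (hF ▸ 𝔠).lane.carrier) j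
                      (fun i : Fin j => r (Fin.castLE (by omega) i)) j),
                  (inputOfAC (hF ▸ 𝔠).lane ((hOf F hF).pkgAt γ hγ hγ1' K).X ((hOf F hF).pkgAt γ hγ hγ1' K).𝔖).W.mass K r W *
                    Real.exp (-(((hOf F hF).pkgAt γ hγ hγ1' K).T.mainT K r W) + ((hOf F hF).pkgAt γ hγ hγ1' K).T.Zterm K r) ≤
                Real.exp CZ * ((F.scheme ℰp γ).β (K - j) ^ A *
                  Real.exp (-(c * B10.pFun (hF ▸ 𝔠).b₀ (hF ▸ 𝔠).p₀ (Real.sqrt (γ * ((F.L : ℝ)⁻¹) ^ (K - j))) ^ 2))))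
    (hlf : ∀ (F : T3Family) (𝔠 : AlphaConsts F.L (suGroupModel 2).N) (h : AlphaInputsT3AC.Of F 𝔠) (γ : ℝ) (hγ : 0 < γ)
      (hγ1 : γ ≤ (min 𝔠.gamma0 1) ^ 2), ∃ CZ : ℝ, ∀ K : ℕ, ∀ᵐ W ∂fieldMeasure (F.P K) K (Matrix.specialUnitaryGroup (Fin 2) ℂ),
        (h.dataT3 γ hγ hγ1 (π F)).LF K K W
            (fun hh => -((h.dataT3 γ hγ hγ1 (π F)).mainT K K hh W) + (h.dataT3 γ hγ hγ1 (π F)).Zterm K K hh) ≤ Real.exp CZ) :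
    ∀ (L : ℕ), ∃ (b₁' p₁' : ℝ), ∀ (b₀ p₀ : ℝ), b₁' ≤ b₀ → p₁' ≤ p₀ → 0 < b₀ → 2 < p₀ → ∀ (m : ℕ), 0 < m →
      ∃ γ₁ : ℝ, 0 < γ₁ ∧ γ₁ ≤ 1 ∧ ∀ (F : T3Family) (γ : ℝ), F.L = L → 0 < γ → γ ≤ γ₁ →
        ∃ (b p C c : ℝ) (A : ℕ), 0 < b ∧ 1 ≤ p ∧ 0 ≤ C ∧ 0 < c ∧
          ∀ (K j : ℕ), 1 ≤ j → j + 2 ≤ K → j + (K - 1) / m ≤ K → ∀ a : Plaq (F.P K) j,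
          (gibbsK F ℰp γ K).real
              ({U : GaugeField (F.P K) 0 (Matrix.specialUnitaryGroup (Fin 2) ℂ) |
                  θBal F.L γ b₀ p₀ (K - j) ≤ GaugeGroup.dist1 (GaugeField.plaqHol
                    (Averaging.iter (fun i' => BlockAveraging.blockAvg (P := F.P K) (j := i') ℰp) j U) a)} ∩
                {U : GaugeField (F.P K) 0 (Matrix.specialUnitaryGroup (Fin 2) ℂ) | ∀ i, i < j →
                  PlaqSmall (θBal F.L γ b₀ p₀ (K - i))
                    (Averaging.iter (fun i' => BlockAveraging.blockAvg (P := F.P K) (j := i') ℰp) i U)}) ≤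
            C * (F.scheme ℰp γ).β (K - j) ^ A *
              Real.exp (-(c * B10.pFun b p (Real.sqrt (γ * ((F.L : ℝ)⁻¹) ^ (K - j))) ^ 2)) :=
  pinnedHeightTail_of'
    (stub_pinnedStepV3_of_package_of_purePinTop_of_main hpkg π hMain
      (hPinA_of_pinnedLF π fun L 𝔠 hOf m hm => hSii L 𝔠 hOf m hm))
    (stub_unitEnvelope_of_package_of_lf_ae_of_main π hpkg hlf hMain)

end Summit.QuantumFields.YangMills.Theorems.UnitScaleTiltHistoryTailOfPackagePinnedLf

end
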